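/-
Copyright: the b2b-balaban T⁴-continuum CRUX team, row NE7b leaf lineage `t4-ne7b-formalise-leaf-02` (gen 136). Project licence.
-/
import Summits.QuantumFields.BalabanUV.T4Continuum.Spine.NE7b.FlatFullFormFloorTorus
import Summits.QuantumFields.BalabanUV.T4Continuum.Spine.NE7b.AdmissibleFloorCoordinates
import Literature.MathematicalPhysics.QuantumFieldTheory.Balaban1983to89.B9SectEKernel

/-!
# THE U = 1 (h2) BINDER IN THE KERNEL'S CURRENCY: the flat full-form floor on the two-scale torus (`…FlatFullFormFloorTorus`, [B6] Lemma 2.4 PROVED)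
# read on the REAL COORDINATES `B : bonds × κ → ℝ` of an orthonormal basis (`…AdmissibleFloorCoordinates`, Parseval) — VERBATIM the hypothesis
# `h2 : ∀ B, good B → c·(B ⬝ᵥ B) ≤ F B` of `B9SectEKernel.gamma0_assembly` — and `gamma0_assembly` BY NAME with (h2) SUPPLIED at `U = 1`
# (row NE7b, node U5c; residual (R2′) family (2), letter (ℓ1); E-side junction — the U = 1 instance of the `γ₀` assembly's (h2) input, no IMS)

Cell `pub-balaban`, sub-cell `t4`, spine estimate NE7b (`T4WeightBudget.RelWeightBound`; the cell's OWN estimate — NOT PRINTED in [Bałaban 1983–89],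
NOT PROVED).  Crux-route work under `Spine/NE7b/` by a row leaf (`t4-ne7b-formalise-leaf-02`, E-side ∕ key-readings ∕ lattice-geometry lineage, gen 136)
under FREEZE (0)'s crux-prover clause; [folklore] junction lemmas BY NAME; NOTHING of Bałaban's is asserted beyond what the cited modules prove; no `def`;
zero `sorry`; no `T4Continuum/Support` leaf.
Imports (hub oleans built): this lineage's `…FlatFullFormFloorTorus` (FFFT `flat_full_form_floor_torus` — [B6] CMP **96** (1984) Lemma 2.4 (2.128) on the
torus, PROVED in the tree via leaf-05's `…FlatFloorLemma24Vector`), leaf-05's `…AdmissibleFloorCoordinates` (AFC `h2_of_normSq_floor` — Parseval on bond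
fields), the reader cell's `Literature.….B9SectEKernel` (`gamma0_assembly` — the written repair `HOME/b2b-balaban-r1/SectE-interface-proof.md` §5 of
[B9] CMP **102** (1985) p. 428 «… positive definite with a lower bound `γ₀ > 0` independent of `k` and `U` …», kernel lemma with (h1), (h2), (hJ) DISPLAYED).

WHY.  `gamma0_assembly` reads the (h2) floor on real vectors `B : m → ℝ` in the `⬝ᵥ` currency; the row's PROVED flat floor (FFFT) reads bond fields
`x : bonds → W` valued in a real inner-product space `W` (print's 𝔲(N) with `Re tr(A†B)`, or `M_m(ℂ)` Hilbert–Schmidt — FFFTO) in the `Σ‖·‖²` currency.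
AFC typed the bridge for ANY floor; leaf-05's `…AdmissibleFloorIMS` §5 typed `gamma0_assembly_of_ims` for the `U ≠ 1` road (IMS: `c∕2 − δ − ε∕2`).  At
`U = 1` no localisation is needed (B9 Sect. E p. 249: «Lemma 2.4′» IS Lemma 2.4 on `T^{(k)}`; g136 ledger §2): THIS FILE plugs FFFT into AFC (§1) and
the result into `gamma0_assembly` (§2) BY NAME, so that at `U = 1` the assembly's (h2) input is DISCHARGED by a tree theorem with print's constant
`c = 1∕(12d²)·n^{−(d+1)}` and NO `½`, `δ`, `ε` losses; §3 is Theorem E1's arithmetic at `δ = ε = 0`.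

WHAT IS PROVED ([folklore]; `W` a real inner-product space with an orthonormal basis `b` indexed by a Fintype `κ` (hence finite-dimensional); bonds
`C := (Fin d → ZMod (n·M)) × Fin d`; `recon v := fun c ↦ b.repr.symm (toLp 2 fun a ↦ v (c, a))` written INLINE as in AFC; TPI's `ι`∕`hι`, TAI's `ιA`∕`hιA`
and FFFT's tree gauge `hT` VERBATIM; `c := 1∕(12d²)·(n^{d+1})⁻¹`; `F(x) := n^{d−2}·Σ_j‖(n^{d+1})⁻¹ • Σ_{rt} x(ιA j rt)‖² + Σ_P‖x(ι P 0) + x(ι P 1) − x(ι P 2) − x(ι P 3)‖²`):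
* §0 `recon_apply_eq_zero_iff` — `recon v c = 0 ↔ ∀ a, v (c, a) = 0`: the tree gauge of `recon v` IS the BASIS-FREE coordinate condition
  `good v := ∀ ȳ ∈ coarseSites, ∀ bd ∈ treeBonds n ȳ, ∀ a, v ((tcls bd.1, bd.2), a) = 0` (a predicate on `C × κ → ℝ` not mentioning `W` or `b`).
* §1 **`h2_flat_full_form_torus`** — for every `v : C × κ → ℝ` with `good v`, `c·(v ⬝ᵥ v) ≤ F(recon v)`:
  VERBATIM `gamma0_assembly`'s `h2` with that basis-free `good` and `F̃ := F ∘ recon` (AFC `h2_of_normSq_floor` on FFFT `flat_full_form_floor_torus`).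
* §2 **`gamma0_assembly_flat_torus`** — `B9SectEKernel.gamma0_assembly` BY NAME at `m := C × κ` with (h2) := §1: for `(K, Q, a, H, P, Jm)` with `QH = 1`,
  `(K + aQᵀQ)H = QᵀP`, and the DISPLAYED letters (h1) `F̃(QA) ≤ κ₁⟨A, KA⟩ + κ₂‖QA‖²`, (hJ) `|⟨B, JmB⟩| ≤ θ‖B‖²`:
  `((c − κ₂)∕κ₁ − θ)·(B ⬝ᵥ B) ≤ B ⬝ᵥ ((P − a·1 − Jm) B)` for every `B` with `good B` (coordinates vanish on the tree bonds).
* §3 **`gamma0_value_flat_ge`** (`0 ≤ c`, `0 < κ₁ ≤ 40`, `κ₂ ≤ c∕8`, `θ ≤ c∕640` ⊢ `c∕640 ≤ (c − κ₂)∕κ₁ − θ` — E1's arithmetic without the IMS letters) and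
  **`gamma0_assembly_flat_torus_value`**: under those letters, `(c∕640)·(B ⬝ᵥ B) ≤ B ⬝ᵥ ((P − a·1 − Jm) B)` for `good B`, `c = 1∕(12d²)·(n^{d+1})⁻¹`.
* §4 toy: `d = 2`, `n = M = 1`, `W = EuclideanSpace ℝ (Fin 1)` with its standard basis, `v = 0` (`good 0` by `rfl`) — §1 elaborates (junction by elaboration).

NOT HERE (honest): (h1), (hJ) and the objects `(K, Q, a, H, P, Jm)` BY VALUE (the (h1) half of the row — CCTL ∕ the OWNER's sup column — and the two
invertibility letters behind `(H, P)`, `…CoerciveFluctuationFloor` §5); WHICH `F` print's step displays at `U = 1` beyond the flat full form ((A3) ∕ (A1c),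
NC-NE7b-α UNRULED — here `F̃ := F ∘ recon` is the flat full form itself, the (h1) consumer must bound THIS functional); `U ≠ 1` (leaf-05's
`gamma0_assembly_of_ims` road: (cov), (pert) — `…TransportSubLetters` —, (flat) — FFFT `flat_letter_torus` —, IMS `ε`); the operator currency (FFFTO §2;
the `⬝ᵥ` coordinates are Hilbert–Schmidt by Parseval); `k > 1`; anything of Bałaban's beyond [B6] Lemma 2.4 PROVED and the r1 kernel lemma.
BY-NAME EFFECT ON THE WALL: NONE (the wall is (R2); this discharges the (h2) INPUT of the `γ₀` assembly at `U = 1`, k = 1, on one finite torus).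
NE7b NOT PRINTED ∕ NOT PROVED; spine PROVED 0∕9; rung (B)+1 on ONE finite T⁴ — NOT infinite volume, NOT the mass gap, NOT Clay.
HONEST DEPENDENCY: continuum YM on T⁴ ⇐ BetaPertH ∧ nine spine estimates (0/9 proved); BetaPertH ⇐ (D1) ∧ (D4) ∧ CAP+tail; G-an2-4 gates asym, D1 and NE2/3/4.
-/

set_option autoImplicit false

noncomputable section

open Finset Matrix WithLp
open Literature.MathematicalPhysics.QuantumFieldTheory.Balaban1983to89.T4TermwiseTorus (tcls)
open Literature.MathematicalPhysics.QuantumFieldTheory.Balaban1983to89.B6BondElimination (treeBonds)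
open Literature.MathematicalPhysics.QuantumFieldTheory.Balaban1983to89.B6Lemma24Torus (coarseSites)
open Literature.MathematicalPhysics.QuantumFieldTheory.Balaban1983to89.B9SectEKernel (gamma0_assembly)
open Summit.QuantumFields.BalabanUV.T4Continuum.NE7b.FlatFullFormFloorTorus (flat_full_form_floor_torus)
open Summit.QuantumFields.BalabanUV.T4Continuum.NE7b.AdmissibleFloorCoordinates (h2_of_normSq_floor)

namespace Summit.QuantumFields.BalabanUV.T4Continuum.NE7b.FlatFullFormFloorCoordinates

variable {d : ℕ} {κ W : Type*} [Fintype κ] [NormedAddCommGroup W] [InnerProductSpace ℝ W]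

/-! ## §0 The tree gauge in coordinates is basis-free -/

/-- `recon v c = 0 ↔ ∀ a, v (c, a) = 0`: a reconstructed vector vanishes iff all its coordinates do (`b.repr.symm` is injective, `toLp` is
injective) — so «`recon v` is in the tree gauge» is the basis-free condition «`v` vanishes on (tree bond) × κ». [folklore] -/
theorem recon_apply_eq_zero_iff (b : OrthonormalBasis κ ℝ W) (f : κ → ℝ) :
    b.repr.symm (toLp 2 f) = 0 ↔ ∀ a, f a = 0 := by
  rw [map_eq_zero_iff _ b.repr.symm.injective, WithLp.toLp_eq_zero, funext_iff]
  rfl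

/-! ## §1 The U = 1 floor on the real coordinates of an orthonormal basis — `gamma0_assembly`'s `h2` verbatim -/

/-- **THE U = 1 (h2) BINDER IN COORDINATES**: for every real coordinate vector `v : bonds × κ → ℝ` whose reconstruction `recon v : bonds → W` along the
orthonormal basis `b` is in the tree gauge — equivalently (§0) `v` vanishes on (tree bond) × κ —, `1∕(12d²)·(n^{d+1})⁻¹·(v ⬝ᵥ v) ≤ F(recon v)`, `F` the flat full form (weighted block averages over TAI's `ιA`
plus plaquette curls over TPI's `ι`) — AFC `h2_of_normSq_floor` on FFFT `flat_full_form_floor_torus`. [folklore] -/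
theorem h2_flat_full_form_torus (hd : 2 ≤ d) (n M : ℕ) [NeZero n] [NeZero M] [NeZero (n * M)]
    (ι : (Fin d → ZMod (n * M)) × {a : Fin d × Fin d // a.1 < a.2} → Fin 4 → (Fin d → ZMod (n * M)) × Fin d)
    (hι : ∀ x a, ι (x, a) = ![(x, a.1.1), (x + Pi.single a.1.1 1, a.1.2), (x + Pi.single a.1.2 1, a.1.1), (x, a.1.2)])
    (ιA : (Fin d → ZMod M) × Fin d → (Fin d → Fin n) × Fin n → (Fin d → ZMod (n * M)) × Fin d)
    (hιA : ∀ y κ r t, ιA (y, κ) (r, t) =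
      ((fun i => (((y i).val * n + (r i : ℕ) : ℕ) : ZMod (n * M))) + Pi.single κ ((t : ℕ) : ZMod (n * M)), κ))
    (b : OrthonormalBasis κ ℝ W) :
    ∀ v : ((Fin d → ZMod (n * M)) × Fin d) × κ → ℝ,
      (∀ y ∈ coarseSites n (fun _ : Fin d => n * M), ∀ bd ∈ treeBonds n y, ∀ a, v ((tcls (n * M) bd.1, bd.2), a) = 0) →
      1 / (12 * (d : ℝ) ^ 2) * ((n : ℝ) ^ (d + 1))⁻¹ * (v ⬝ᵥ v) ≤
        (n : ℝ) ^ (d - 2) * ∑ j, ‖((n : ℝ) ^ (d + 1))⁻¹ •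
              ∑ rt, (fun c' => b.repr.symm (toLp 2 fun a => v (c', a))) (ιA j rt)‖ ^ 2
          + ∑ P, ‖(fun c' => b.repr.symm (toLp 2 fun a => v (c', a))) (ι P 0)
              + (fun c' => b.repr.symm (toLp 2 fun a => v (c', a))) (ι P 1)
              - (fun c' => b.repr.symm (toLp 2 fun a => v (c', a))) (ι P 2)
              - (fun c' => b.repr.symm (toLp 2 fun a => v (c', a))) (ι P 3)‖ ^ 2 := by
  haveI : FiniteDimensional ℝ W := Module.Finite.of_basis b.toBasis
  intro v hv
  exact h2_of_normSq_floor b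
    (fun x => (n : ℝ) ^ (d - 2) * ∑ j, ‖((n : ℝ) ^ (d + 1))⁻¹ • ∑ rt, x (ιA j rt)‖ ^ 2
      + ∑ P, ‖x (ι P 0) + x (ι P 1) - x (ι P 2) - x (ι P 3)‖ ^ 2)
    (fun x => ∀ y ∈ coarseSites n (fun _ : Fin d => n * M), ∀ bd ∈ treeBonds n y, x (tcls (n * M) bd.1, bd.2) = 0)
    (fun x hx => flat_full_form_floor_torus hd n M ι hι ιA hιA x hx) v
    (fun y hy bd hbd => (recon_apply_eq_zero_iff b _).mpr (hv y hy bd hbd))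

/-! ## §2 `gamma0_assembly` BY NAME with (h2) supplied at U = 1 -/

/-- **THE `γ₀` ASSEMBLY AT U = 1 ON THE TWO-SCALE TORUS, (h2) DISCHARGED**: `B9SectEKernel.gamma0_assembly` BY NAME at `m := bonds × κ` with
`good` := the basis-free coordinate tree gauge of §0–§1, `F̃ := F ∘ recon` and (h2) := §1; (h1), (hJ) and `(K, Q, a, H, P, Jm)` stay DISPLAYED:
`((c − κ₂)∕κ₁ − θ)·(B ⬝ᵥ B) ≤ B ⬝ᵥ ((P − a·1 − Jm) B)`, `c = 1∕(12d²)·(n^{d+1})⁻¹` — no `½`, no `δ`, no `ε`. [folklore] -/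
theorem gamma0_assembly_flat_torus [DecidableEq κ] (hd : 2 ≤ d) (n M : ℕ) [NeZero n] [NeZero M] [NeZero (n * M)]
    (ι : (Fin d → ZMod (n * M)) × {a : Fin d × Fin d // a.1 < a.2} → Fin 4 → (Fin d → ZMod (n * M)) × Fin d)
    (hι : ∀ x a, ι (x, a) = ![(x, a.1.1), (x + Pi.single a.1.1 1, a.1.2), (x + Pi.single a.1.2 1, a.1.1), (x, a.1.2)])
    (ιA : (Fin d → ZMod M) × Fin d → (Fin d → Fin n) × Fin n → (Fin d → ZMod (n * M)) × Fin d)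
    (hιA : ∀ y κ r t, ιA (y, κ) (r, t) =
      ((fun i => (((y i).val * n + (r i : ℕ) : ℕ) : ZMod (n * M))) + Pi.single κ ((t : ℕ) : ZMod (n * M)), κ))
    (b : OrthonormalBasis κ ℝ W)
    {nn : Type*} [Fintype nn] [DecidableEq nn]
    (K : Matrix nn nn ℝ) (Q : Matrix (((Fin d → ZMod (n * M)) × Fin d) × κ) nn ℝ) (a : ℝ)
    (H : Matrix nn (((Fin d → ZMod (n * M)) × Fin d) × κ) ℝ)
    (P Jm : Matrix (((Fin d → ZMod (n * M)) × Fin d) × κ) (((Fin d → ZMod (n * M)) × Fin d) × κ) ℝ)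
    (hQH : Q * H = 1) (hSH : (K + a • (Qᵀ * Q)) * H = Qᵀ * P) {κ₁ κ₂ θ : ℝ} (hκ₁ : 0 < κ₁)
    (h1 : ∀ A : nn → ℝ,
      ((n : ℝ) ^ (d - 2) * ∑ j, ‖((n : ℝ) ^ (d + 1))⁻¹ •
              ∑ rt, (fun c' => b.repr.symm (toLp 2 fun a' => (Q *ᵥ A) (c', a'))) (ιA j rt)‖ ^ 2
          + ∑ P', ‖(fun c' => b.repr.symm (toLp 2 fun a' => (Q *ᵥ A) (c', a'))) (ι P' 0)
              + (fun c' => b.repr.symm (toLp 2 fun a' => (Q *ᵥ A) (c', a'))) (ι P' 1)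
              - (fun c' => b.repr.symm (toLp 2 fun a' => (Q *ᵥ A) (c', a'))) (ι P' 2)
              - (fun c' => b.repr.symm (toLp 2 fun a' => (Q *ᵥ A) (c', a'))) (ι P' 3)‖ ^ 2)
        ≤ κ₁ * (A ⬝ᵥ (K *ᵥ A)) + κ₂ * ((Q *ᵥ A) ⬝ᵥ (Q *ᵥ A)))
    (hJ : ∀ B : ((Fin d → ZMod (n * M)) × Fin d) × κ → ℝ, |B ⬝ᵥ (Jm *ᵥ B)| ≤ θ * (B ⬝ᵥ B))
    (B : ((Fin d → ZMod (n * M)) × Fin d) × κ → ℝ)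
    (hB : ∀ y ∈ coarseSites n (fun _ : Fin d => n * M), ∀ bd ∈ treeBonds n y, ∀ a', B ((tcls (n * M) bd.1, bd.2), a') = 0) :
    ((1 / (12 * (d : ℝ) ^ 2) * ((n : ℝ) ^ (d + 1))⁻¹ - κ₂) / κ₁ - θ) * (B ⬝ᵥ B) ≤
      B ⬝ᵥ ((P - a • (1 : Matrix _ _ ℝ) - Jm) *ᵥ B) :=
  gamma0_assembly K Q a H P Jm hQH hSH
    (fun v => ∀ y ∈ coarseSites n (fun _ : Fin d => n * M), ∀ bd ∈ treeBonds n y, ∀ a', v ((tcls (n * M) bd.1, bd.2), a') = 0)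
    (fun v => (n : ℝ) ^ (d - 2) * ∑ j, ‖((n : ℝ) ^ (d + 1))⁻¹ •
              ∑ rt, (fun c' => b.repr.symm (toLp 2 fun a' => v (c', a'))) (ιA j rt)‖ ^ 2
          + ∑ P', ‖(fun c' => b.repr.symm (toLp 2 fun a' => v (c', a'))) (ι P' 0)
              + (fun c' => b.repr.symm (toLp 2 fun a' => v (c', a'))) (ι P' 1)
              - (fun c' => b.repr.symm (toLp 2 fun a' => v (c', a'))) (ι P' 2)
              - (fun c' => b.repr.symm (toLp 2 fun a' => v (c', a'))) (ι P' 3)‖ ^ 2)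
    hκ₁ h1 (h2_flat_full_form_torus hd n M ι hι ιA hιA b) hJ B hB

/-! ## §3 Theorem E1's arithmetic at U = 1 (no IMS letters) -/

/-- **E1's ARITHMETIC WITHOUT THE IMS LETTERS**: `0 ≤ c`, `0 < κ₁ ≤ 40`, `κ₂ ≤ c∕8`, `θ ≤ c∕640` give `c∕640 ≤ (c − κ₂)∕κ₁ − θ` (cf. leaf-05's
`…AdmissibleFloorIMS.gamma0_value_ge` with `δ = ε = 0`; here even the structural `½` is absent). [folklore] -/
theorem gamma0_value_flat_ge {c κ₁ κ₂ θ : ℝ} (hc : 0 ≤ c) (hκ₁ : 0 < κ₁) (hκ₁' : κ₁ ≤ 40)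
    (hκ₂ : κ₂ ≤ c / 8) (hθ : θ ≤ c / 640) :
    c / 640 ≤ (c - κ₂) / κ₁ - θ := by
  have hnum : c / 8 ≤ c - κ₂ := by linarith
  have hq : c / 320 ≤ (c - κ₂) / κ₁ := by
    rw [le_div_iff₀ hκ₁]
    have : c / 320 * κ₁ ≤ c / 320 * 40 := mul_le_mul_of_nonneg_left hκ₁' (by positivity)
    linarith
  linarith

/-- **THE `γ₀` FLOOR AT U = 1 BY VALUE `c∕640`, `c = 1∕(12d²)·(n^{d+1})⁻¹`**: §2 under Theorem E1's letters `0 < κ₁ ≤ 40`, `κ₂ ≤ c∕8`, `θ ≤ c∕640`: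
`(c∕640)·(B ⬝ᵥ B) ≤ B ⬝ᵥ ((P − a·1 − Jm) B)` for every `B` vanishing on (tree bond) × κ. [folklore] -/
theorem gamma0_assembly_flat_torus_value [DecidableEq κ] (hd : 2 ≤ d) (n M : ℕ) [NeZero n] [NeZero M] [NeZero (n * M)]
    (ι : (Fin d → ZMod (n * M)) × {a : Fin d × Fin d // a.1 < a.2} → Fin 4 → (Fin d → ZMod (n * M)) × Fin d)
    (hι : ∀ x a, ι (x, a) = ![(x, a.1.1), (x + Pi.single a.1.1 1, a.1.2), (x + Pi.single a.1.2 1, a.1.1), (x, a.1.2)])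
    (ιA : (Fin d → ZMod M) × Fin d → (Fin d → Fin n) × Fin n → (Fin d → ZMod (n * M)) × Fin d)
    (hιA : ∀ y κ r t, ιA (y, κ) (r, t) =
      ((fun i => (((y i).val * n + (r i : ℕ) : ℕ) : ZMod (n * M))) + Pi.single κ ((t : ℕ) : ZMod (n * M)), κ))
    (b : OrthonormalBasis κ ℝ W)
    {nn : Type*} [Fintype nn] [DecidableEq nn]
    (K : Matrix nn nn ℝ) (Q : Matrix (((Fin d → ZMod (n * M)) × Fin d) × κ) nn ℝ) (a : ℝ)
    (H : Matrix nn (((Fin d → ZMod (n * M)) × Fin d) × κ) ℝ)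
    (P Jm : Matrix (((Fin d → ZMod (n * M)) × Fin d) × κ) (((Fin d → ZMod (n * M)) × Fin d) × κ) ℝ)
    (hQH : Q * H = 1) (hSH : (K + a • (Qᵀ * Q)) * H = Qᵀ * P) {κ₁ κ₂ θ : ℝ} (hκ₁ : 0 < κ₁) (hκ₁' : κ₁ ≤ 40)
    (hκ₂ : κ₂ ≤ 1 / (12 * (d : ℝ) ^ 2) * ((n : ℝ) ^ (d + 1))⁻¹ / 8)
    (hθ : θ ≤ 1 / (12 * (d : ℝ) ^ 2) * ((n : ℝ) ^ (d + 1))⁻¹ / 640)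
    (h1 : ∀ A : nn → ℝ,
      ((n : ℝ) ^ (d - 2) * ∑ j, ‖((n : ℝ) ^ (d + 1))⁻¹ •
              ∑ rt, (fun c' => b.repr.symm (toLp 2 fun a' => (Q *ᵥ A) (c', a'))) (ιA j rt)‖ ^ 2
          + ∑ P', ‖(fun c' => b.repr.symm (toLp 2 fun a' => (Q *ᵥ A) (c', a'))) (ι P' 0)
              + (fun c' => b.repr.symm (toLp 2 fun a' => (Q *ᵥ A) (c', a'))) (ι P' 1)
              - (fun c' => b.repr.symm (toLp 2 fun a' => (Q *ᵥ A) (c', a'))) (ι P' 2)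
              - (fun c' => b.repr.symm (toLp 2 fun a' => (Q *ᵥ A) (c', a'))) (ι P' 3)‖ ^ 2)
        ≤ κ₁ * (A ⬝ᵥ (K *ᵥ A)) + κ₂ * ((Q *ᵥ A) ⬝ᵥ (Q *ᵥ A)))
    (hJ : ∀ B : ((Fin d → ZMod (n * M)) × Fin d) × κ → ℝ, |B ⬝ᵥ (Jm *ᵥ B)| ≤ θ * (B ⬝ᵥ B))
    (B : ((Fin d → ZMod (n * M)) × Fin d) × κ → ℝ)
    (hB : ∀ y ∈ coarseSites n (fun _ : Fin d => n * M), ∀ bd ∈ treeBonds n y, ∀ a', B ((tcls (n * M) bd.1, bd.2), a') = 0) :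
    1 / (12 * (d : ℝ) ^ 2) * ((n : ℝ) ^ (d + 1))⁻¹ / 640 * (B ⬝ᵥ B) ≤
      B ⬝ᵥ ((P - a • (1 : Matrix _ _ ℝ) - Jm) *ᵥ B) := by
  have hc : (0 : ℝ) ≤ 1 / (12 * (d : ℝ) ^ 2) * ((n : ℝ) ^ (d + 1))⁻¹ := by positivity
  have hγ := gamma0_value_flat_ge hc hκ₁ hκ₁' hκ₂ hθ
  have hBB : 0 ≤ B ⬝ᵥ B := by
    simp only [dotProduct]
    exact Finset.sum_nonneg fun i _ => mul_self_nonneg (B i)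
  exact (mul_le_mul_of_nonneg_right hγ hBB).trans
    (gamma0_assembly_flat_torus hd n M ι hι ιA hιA b K Q a H P Jm hQH hSH hκ₁ h1 hJ B hB)

/-! ## §4 Toy: `d = 2`, `n = M = 1`, `W = ℝ¹`, the zero vector -/

/- One-point two-scale torus, `W = EuclideanSpace ℝ (Fin 1)` with its standard orthonormal basis, `v = 0` (`good 0` coordinatewise by `rfl`):
§1 elaborates and reads `c·0 ≤ F 0` (junction by elaboration). -/
example : 1 / (12 * ((2 : ℕ) : ℝ) ^ 2) * (((1 : ℕ) : ℝ) ^ (2 + 1))⁻¹ *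
      ((fun _ : ((Fin 2 → ZMod (1 * 1)) × Fin 2) × Fin 1 => (0 : ℝ)) ⬝ᵥ (fun _ => (0 : ℝ))) ≤
    ((1 : ℕ) : ℝ) ^ (2 - 2) * ∑ j : (Fin 2 → ZMod 1) × Fin 2, ‖(((1 : ℕ) : ℝ) ^ (2 + 1))⁻¹ •
          ∑ rt : (Fin 2 → Fin 1) × Fin 1, (fun c' : (Fin 2 → ZMod (1 * 1)) × Fin 2 =>
            (EuclideanSpace.basisFun (Fin 1) ℝ).repr.symm (toLp 2 fun a =>
              (fun _ : ((Fin 2 → ZMod (1 * 1)) × Fin 2) × Fin 1 => (0 : ℝ)) (c', a)))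
            ((fun (j : (Fin 2 → ZMod 1) × Fin 2) (rt : (Fin 2 → Fin 1) × Fin 1) =>
              ((fun i => (((j.1 i).val * 1 + (rt.1 i : ℕ) : ℕ) : ZMod (1 * 1))) + Pi.single j.2 ((rt.2 : ℕ) : ZMod (1 * 1)), j.2)) j rt)‖ ^ 2
      + ∑ P : (Fin 2 → ZMod (1 * 1)) × {a : Fin 2 × Fin 2 // a.1 < a.2},
          ‖(fun c' : (Fin 2 → ZMod (1 * 1)) × Fin 2 => (EuclideanSpace.basisFun (Fin 1) ℝ).repr.symm (toLp 2 fun a =>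
              (fun _ : ((Fin 2 → ZMod (1 * 1)) × Fin 2) × Fin 1 => (0 : ℝ)) (c', a)))
              ((fun (q : (Fin 2 → ZMod (1 * 1)) × {a : Fin 2 × Fin 2 // a.1 < a.2}) =>
                ![(q.1, q.2.1.1), (q.1 + Pi.single q.2.1.1 1, q.2.1.2), (q.1 + Pi.single q.2.1.2 1, q.2.1.1), (q.1, q.2.1.2)]) P 0)
            + (fun c' : (Fin 2 → ZMod (1 * 1)) × Fin 2 => (EuclideanSpace.basisFun (Fin 1) ℝ).repr.symm (toLp 2 fun a =>
              (fun _ : ((Fin 2 → ZMod (1 * 1)) × Fin 2) × Fin 1 => (0 : ℝ)) (c', a)))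
              ((fun (q : (Fin 2 → ZMod (1 * 1)) × {a : Fin 2 × Fin 2 // a.1 < a.2}) =>
                ![(q.1, q.2.1.1), (q.1 + Pi.single q.2.1.1 1, q.2.1.2), (q.1 + Pi.single q.2.1.2 1, q.2.1.1), (q.1, q.2.1.2)]) P 1)
            - (fun c' : (Fin 2 → ZMod (1 * 1)) × Fin 2 => (EuclideanSpace.basisFun (Fin 1) ℝ).repr.symm (toLp 2 fun a =>
              (fun _ : ((Fin 2 → ZMod (1 * 1)) × Fin 2) × Fin 1 => (0 : ℝ)) (c', a)))
              ((fun (q : (Fin 2 → ZMod (1 * 1)) × {a : Fin 2 × Fin 2 // a.1 < a.2}) =>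
                ![(q.1, q.2.1.1), (q.1 + Pi.single q.2.1.1 1, q.2.1.2), (q.1 + Pi.single q.2.1.2 1, q.2.1.1), (q.1, q.2.1.2)]) P 2)
            - (fun c' : (Fin 2 → ZMod (1 * 1)) × Fin 2 => (EuclideanSpace.basisFun (Fin 1) ℝ).repr.symm (toLp 2 fun a =>
              (fun _ : ((Fin 2 → ZMod (1 * 1)) × Fin 2) × Fin 1 => (0 : ℝ)) (c', a)))
              ((fun (q : (Fin 2 → ZMod (1 * 1)) × {a : Fin 2 × Fin 2 // a.1 < a.2}) =>
                ![(q.1, q.2.1.1), (q.1 + Pi.single q.2.1.1 1, q.2.1.2), (q.1 + Pi.single q.2.1.2 1, q.2.1.1), (q.1, q.2.1.2)]) P 3)‖ ^ 2 := by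
  haveI : NeZero (1 * 1) := ⟨by norm_num⟩
  exact h2_flat_full_form_torus (W := EuclideanSpace ℝ (Fin 1)) le_rfl 1 1
    (fun q => ![(q.1, q.2.1.1), (q.1 + Pi.single q.2.1.1 1, q.2.1.2), (q.1 + Pi.single q.2.1.2 1, q.2.1.1), (q.1, q.2.1.2)])
    (fun _ _ => rfl)
    (fun j rt => ((fun i => (((j.1 i).val * 1 + (rt.1 i : ℕ) : ℕ) : ZMod (1 * 1))) + Pi.single j.2 ((rt.2 : ℕ) : ZMod (1 * 1)), j.2))
    (fun _ _ _ _ => rfl) (EuclideanSpace.basisFun (Fin 1) ℝ) (fun _ => 0) (fun _ _ _ _ _ => rfl)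

end Summit.QuantumFields.BalabanUV.T4Continuum.NE7b.FlatFullFormFloorCoordinates

end
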